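/-
Copyright (c) 2026 the pub-hodgecm-mathlib formalisation cell (harness21).  Prover seat hodgecm-mathlib-K2E1-p12 (g5), Track B ∕ K2-LIT, h413 = `stmt-HodgeConjecture-24833`,
R90-TF section S8 «ContSpec-n½», letter (V♭) «of letters» (S8 dealer report #3 (E) 2026-09-04T23:30:04Z: (V♭) unassigned; B ED. 5 :575 names it for #2♯): the SHARP VANISHING
companion of the ★ (V) seam p862780 — «no pole of the continued Eisenstein family at `z₀ = 3/2` ⇒ the middle block `resGMidBlock ξ μω` is `⊥`».
-/
import Summits.HodgeConjecture.HodgeConjecture.Theorems.R90S8ResGMidAtomU3Defs       -- ★ p862682 (K2E1-p11): `resGMidAtomGen ∕ resGMidAtom ∕ resGMidBlock`, `resGMidAtom_def`, `resGMidBlock_le`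
import Summits.HodgeConjecture.HodgeConjecture.Theorems.K2E1HeckeLHalfNeZeroDefs      -- ★ `LHalfNeZero` (the central-value clause of #2♯ ∕ (V))
import HarnessLib

/-!
# S8 — `R90S8ResGMidBlockEqBotOfLettersU3`: (V♭) OF LETTERS — NO POLE AT `z₀ = 3/2` ⇒ THE MIDDLE BLOCK `resGMidBlock ξ μω` IS `⊥`

Track B ∕ R90-TF, crux h413 = `stmt-HodgeConjecture-24833`, route of record `HCCMUnconditional`; cell `hodgecm-mathlib`, section S8 «ContSpec-n½», sockets (V) :300 ∕ #2♯ :575 of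
`Lines/R90_S8_ResidualSpectrumU3B.lean` (ED. 5).  THEOREMS ONLY (no `def`, no `instance`, no `notation`, no named-fact hypothesis, no `sorry`; default heartbeats); lane
`--supports stmt-HodgeConjecture-24833 --as helper` (count-neutral).  CLOSES NO SOCKET.  B ED. 5's census for #2♯ (:566–575) names the SHARP VANISHING letter
(V♭) «`¬ LHalfNeZero (ξ.bcη⁻¹ * μω) → resGMidBlock L μ ξ μω = ⊥`» (no residue at `s = ½` when `L(½, φ_ξ) = 0`; row T2.1 (γ) + E2.G9.4 (ii)) as the missing passage from (E)'s full
index `OneDimAutRepH L` to the subtype `{ξ ∣ L(½, φ_ξ) ≠ 0}` in ★ F2_qs.  This file pays its HILBERT-SPACE ∕ COMPLEX-ANALYSIS half, hypothesis-first on ONE analytic letter — the converse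
companion of the ★ (V) seam `resGMidBlock_ne_bot_of_letters` (p862780).

THE MATHEMATICS ([Rogawski1990, §13.9 p. 229 (ii)]; [MoeglinWaldspurger1995, IV.1.11, V.3.13]; [Langlands1976, §7]).  The middle block `resGMidBlock ξ μω` (★ D3) is the closed
`R(G(𝔸))`-hull of the atoms `resGMidAtom ξ μω K′ ω` (★ D2), the closed spans of the GENERATORS (★ D1): classes a.e. equal to `x ↦ Fp((out x)⁻¹)(3/2)` for a POLE LETTER `Fp` at `z₀ = 3/2`
(`Fp g` analytic at `3/2`, `Fp g = (z − 3/2)·Ec z g` on a punctured neighbourhood) of an admissible continuation `Ec` of the Eisenstein family of a section `φ` of the `φ_ξ`-block.  IF the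
continued family has NO POLE at `3/2` — letter (NP) `(z − 3/2)·Ec z g → 0` as `z → 3/2`, `z ≠ 3/2`, for every admissible `(φ, Ec, Sp)` and every `g` — then `Fp g (3/2) = lim Fp g = lim (z −
3/2)·Ec z g = 0` (uniqueness of limits in the punctured filter, §1), every generator is a.e. `0`, every atom is `⊥` (§2) and the hull is `⊥` (★ `resGMidBlock_le ⊥`, §3).  When
`L(½, φ_ξ) = 0` the numerator `L(2z − 2, φ_ξ)`-type factor of the intertwining scalar vanishes at `z = 3/2` and cancels the simple pole of the `ζ`-type factor, so the constant term — hence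
the Eisenstein family [Lai §3; MW IV.1.11] — is holomorphic at `3/2`: that is (NP), paid later by the scalar road ((a-2) `K2E1ChiIntertwiningScalarEulerProductU3` ∘ CT ∘ `hr2`); here it is
the VISIBLE binder `hNP`, and §3 records the junction `(¬ LHalfNeZero → NP) → ¬ LHalfNeZero → resGMidBlock = ⊥` in #2♯'s binder types.
* §1 `eq_zero_of_analyticAt_of_eventuallyEq_sub_mul` — generic: `Fp` analytic at `z₀`, `Fp =ᶠ[𝓝[≠] z₀] (z − z₀)·E z`, `(z − z₀)·E z → 0` on `𝓝[≠] z₀` ⟹ `Fp z₀ = 0`.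
* §2 `resGMidAtomGen_subset_zero_of_noMiddlePole`, `resGMidAtom_eq_bot_of_noMiddlePole` — at one level `(K′, ω)` under (NP) at that level.
* §3 **`resGMidBlock_eq_bot_of_noMiddlePole`** (HEAD: (NP) at every level ⟹ `resGMidBlock L μ ξ μω = ⊥`), **`resGMidBlock_eq_bot_of_not_lHalfNeZero_of_letters`** (the (V♭) bytes of
  B ED. 5 :575 modulo the letter `hV♭ : ¬ LHalfNeZero (ξ.bcη⁻¹ * μω) → (NP)`), `lHalfNeZero_of_resGMidBlock_ne_bot_of_letters` (contrapositive, the shape ★ F2_qs's index passage uses).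
HONEST LABEL: HC_CM is proved only modulo the 7 printed citations (2 remaining named inputs: hLiu418 = `stmt-HodgeConjecture-24832`, h413 = `stmt-HodgeConjecture-24833`) until
rung 0 closes; REL ≠ ★ ≠ BUILT; this file asserts no named fact, is conditional by construction on the visible analytic letter (NP) ∕ `hV♭`, and closes no socket; count-neutral.

## References
* [Rogawski1990] J. D. Rogawski, *Automorphic Representations of Unitary Groups in Three Variables* (1990), §13.9 p. 229 (ii).
* [MoeglinWaldspurger1995] C. Mœglin, J.-L. Waldspurger, *Spectral Decomposition and Eisenstein Series* (1995), IV.1.11, V.3.13.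
* [Langlands1976] R. P. Langlands, *On the Functional Equations Satisfied by Eisenstein Series*, LNM 544 (1976), §7.
-/

set_option autoImplicit false
set_option linter.dupNamespace false  -- the mandated namespace `…HodgeConjecture.HodgeConjecture.R90.S8` (LEAD #1 L1) repeats the summit's segment

noncomputable section

open MeasureTheory Measure Set Filter Topology NumberField
open scoped ENNReal NNReal Topology
open Literature.NumberTheory.Automorphic Literature.NumberTheory.Automorphic.UnitaryGroup Literature.NumberTheory.GaloisRepresentations AdelicGroupData ContRepresentation
open Literature.NumberTheory.Automorphic.Arthur2013.Leaves.TECR Literature.NumberTheory.Rogawski1990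
open Summit.HodgeConjecture.HodgeConjecture.Cruxes.H413.K2E1BorelEisensteinU
open Summit.HodgeConjecture.HodgeConjecture.Cruxes.H413.K2E1ChiSectionSpaceU3PairDefs
open Summit.HodgeConjecture.HodgeConjecture.Cruxes.H413.K2E1HeckeLHalfNeZeroDefs (LHalfNeZero)

namespace Summit.HodgeConjecture.HodgeConjecture.R90.S8

/-! ## §1 Generic: a pole letter of a family with no pole vanishes at the point -/

/-- **A POLE LETTER OF A POLE-FREE FAMILY VANISHES**: if `Fp` is analytic at `z₀`, agrees with `(z − z₀)·E z` on a punctured neighbourhood of `z₀`, and `(z − z₀)·E z → 0` along the punctured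
neighbourhood filter, then `Fp z₀ = 0` (continuity of `Fp` at `z₀` + uniqueness of limits; `𝓝[≠] z₀` is non-trivial in `ℂ`). [cite: MoeglinWaldspurger1995, IV.1.11] -/
theorem eq_zero_of_analyticAt_of_eventuallyEq_sub_mul {Fp E : ℂ → ℂ} {z₀ : ℂ} (hFp : AnalyticAt ℂ Fp z₀)
    (hev : Fp =ᶠ[𝓝[≠] z₀] fun z => (z - z₀) * E z) (hE : Tendsto (fun z => (z - z₀) * E z) (𝓝[≠] z₀) (𝓝 0)) : Fp z₀ = 0 :=
  tendsto_nhds_unique ((hFp.continuousAt.tendsto.mono_left nhdsWithin_le_nhds).congr' hev) hE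

/-! ## §2 One level `(K′, ω)`: under «no pole at `3/2`» every generator is `0`, so the atom is `⊥` -/

variable (L : Type) [Field L] [NumberField L] [IsCMField L]
  (μ : Measure (quasiSplit (↥(maximalRealSubfield L)) L (IsCMField.complexConj L) 3).automorphicQuotient) (ξ : OneDimAutRepH L) (μω : HeckeCharacter L)
  (K' : Subgroup (quasiSplit (↥(maximalRealSubfield L)) L (IsCMField.complexConj L) 3).Adelic) (ω : ↥K' →* ℂ)

/-- **THE GENERATORS VANISH** under the letter (NP) «no pole at `z₀ = 3/2`» at the level `(K′, ω)`: for every continuous section `φ` of the `φ_ξ`-block, every admissible continuation `(Ec, Sp)`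
(★ D1's clauses verbatim) and every `g`, `(z − 3/2)·Ec z g → 0` on `𝓝[≠] (3/2)` ⟹ `resGMidAtomGen ξ μω K′ ω ⊆ {0}` (§1 at each `g`, then the class is a.e. `0`).
[cite: Rogawski1990, §13.9 p. 229 (ii)] [cite: MoeglinWaldspurger1995, IV.1.11, V.3.13] -/
theorem resGMidAtomGen_subset_zero_of_noMiddlePole
    (hNP : ∀ φ ∈ chiSectionSpacePair (ξ.bcη⁻¹ * ξ.bcψ⁻¹ * μω) ξ.ψ K' (ω : ↥K' → ℂ), Continuous φ →
      ∀ (Ec : ℂ → (quasiSplit (↥(maximalRealSubfield L)) L (IsCMField.complexConj L) 3).Adelic → ℂ) (Sp : Finset ℂ), (∀ s ∈ Sp, s.im = 0 ∧ 1 < s.re ∧ s.re ≤ 2) →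
        (∀ g, DifferentiableOn ℂ (fun z => Ec z g) ({z : ℂ | 1 < z.re} \ (↑Sp : Set ℂ))) → (∀ z : ℂ, 2 < z.re → Ec z = eisensteinSeriesU (flatSectionU φ z)) →
          ∀ g, Tendsto (fun z => (z - (3 : ℂ) / 2) * Ec z g) (𝓝[≠] ((3 : ℂ) / 2)) (𝓝 0)) :
    resGMidAtomGen L μ ξ μω K' ω ⊆ {0} := by
  rintro f ⟨φ, hφ, hφc, Ec, Sp, hSp, hhol, hEis, Fp, hFp, hFpE, hf⟩
  have h0 : ∀ g, Fp g ((3 : ℂ) / 2) = 0 := fun g =>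
    eq_zero_of_analyticAt_of_eventuallyEq_sub_mul (hFp g) (hFpE g) (hNP φ hφ hφc Ec Sp hSp hhol hEis g)
  refine Set.mem_singleton_iff.2 (Lp.ext (hf.trans ?_))
  have hz : (fun x : (quasiSplit (↥(maximalRealSubfield L)) L (IsCMField.complexConj L) 3).automorphicQuotient => Fp (Quotient.out (x : (quasiSplit (↥(maximalRealSubfield L)) L (IsCMField.complexConj L) 3).Adelic ⧸ (quasiSplit (↥(maximalRealSubfield L)) L (IsCMField.complexConj L) 3).quotientSubgroup))⁻¹ ((3 : ℂ) / 2)) = fun _ => (0 : ℂ) :=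
    funext fun x => h0 _
  rw [hz]
  exact (Lp.coeFn_zero ℂ 2 μ).symm

/-- **THE ATOM IS `⊥`** under (NP) at the level `(K′, ω)`: the closed span of a subset of `{0}` is `⊥`. [cite: MoeglinWaldspurger1995, V.3.13] -/
theorem resGMidAtom_eq_bot_of_noMiddlePole
    (hNP : ∀ φ ∈ chiSectionSpacePair (ξ.bcη⁻¹ * ξ.bcψ⁻¹ * μω) ξ.ψ K' (ω : ↥K' → ℂ), Continuous φ →
      ∀ (Ec : ℂ → (quasiSplit (↥(maximalRealSubfield L)) L (IsCMField.complexConj L) 3).Adelic → ℂ) (Sp : Finset ℂ), (∀ s ∈ Sp, s.im = 0 ∧ 1 < s.re ∧ s.re ≤ 2) →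
        (∀ g, DifferentiableOn ℂ (fun z => Ec z g) ({z : ℂ | 1 < z.re} \ (↑Sp : Set ℂ))) → (∀ z : ℂ, 2 < z.re → Ec z = eisensteinSeriesU (flatSectionU φ z)) →
          ∀ g, Tendsto (fun z => (z - (3 : ℂ) / 2) * Ec z g) (𝓝[≠] ((3 : ℂ) / 2)) (𝓝 0)) :
    resGMidAtom L μ ξ μω K' ω = ⊥ := by
  have hspan : Submodule.span ℂ (resGMidAtomGen L μ ξ μω K' ω) = ⊥ :=
    Submodule.span_eq_bot.2 fun f hf => Set.mem_singleton_iff.1 (resGMidAtomGen_subset_zero_of_noMiddlePole L μ ξ μω K' ω hNP hf)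
  have hcl : IsClosed ((⊥ : Submodule ℂ ((quasiSplit (↥(maximalRealSubfield L)) L (IsCMField.complexConj L) 3).L2 μ)) : Set ((quasiSplit (↥(maximalRealSubfield L)) L (IsCMField.complexConj L) 3).L2 μ)) := by
    rw [Submodule.bot_coe]; exact isClosed_singleton
  rw [resGMidAtom_def, hspan, hcl.submodule_topologicalClosure_eq]

/-! ## §3 The hull: (NP) at every level ⟹ `resGMidBlock ξ μω = ⊥`; the (V♭) junction with `¬ LHalfNeZero` -/

variable [(quasiSplit (↥(maximalRealSubfield L)) L (IsCMField.complexConj L) 3).IsAutomorphicMeasure μ]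

/-- **(V♭) HEAD — NO POLE AT `3/2` ⟹ THE MIDDLE BLOCK IS `⊥`**: if (NP) holds at EVERY level `(K′, ω)`, then `resGMidBlock L μ ξ μω = ⊥` (every atom is `⊥` by §2; ★ `resGMidBlock_le ⊥`).
[cite: Rogawski1990, §13.9 p. 229 (ii)] [cite: MoeglinWaldspurger1995, IV.1.11, V.3.13] [cite: Langlands1976, §7] -/
theorem resGMidBlock_eq_bot_of_noMiddlePole
    (hNP : ∀ (K' : Subgroup (quasiSplit (↥(maximalRealSubfield L)) L (IsCMField.complexConj L) 3).Adelic) (ω : ↥K' →* ℂ), ∀ φ ∈ chiSectionSpacePair (ξ.bcη⁻¹ * ξ.bcψ⁻¹ * μω) ξ.ψ K' (ω : ↥K' → ℂ), Continuous φ →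
      ∀ (Ec : ℂ → (quasiSplit (↥(maximalRealSubfield L)) L (IsCMField.complexConj L) 3).Adelic → ℂ) (Sp : Finset ℂ), (∀ s ∈ Sp, s.im = 0 ∧ 1 < s.re ∧ s.re ≤ 2) →
        (∀ g, DifferentiableOn ℂ (fun z => Ec z g) ({z : ℂ | 1 < z.re} \ (↑Sp : Set ℂ))) → (∀ z : ℂ, 2 < z.re → Ec z = eisensteinSeriesU (flatSectionU φ z)) →
          ∀ g, Tendsto (fun z => (z - (3 : ℂ) / 2) * Ec z g) (𝓝[≠] ((3 : ℂ) / 2)) (𝓝 0)) :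
    resGMidBlock L μ ξ μω = ⊥ :=
  le_bot_iff.1 (resGMidBlock_le L μ ξ μω ⊥ fun K' ω => by
    rw [resGMidAtom_eq_bot_of_noMiddlePole L μ ξ μω K' ω (hNP K' ω), ClosedSubrep.toSubmodule_bot])

/-- **(V♭) OF LETTERS — THE BYTES B ED. 5 :575 NAMES**: `¬ LHalfNeZero (ξ.bcη⁻¹ * μω) → resGMidBlock L μ ξ μω = ⊥`, GIVEN the analytic letter `hV♭` «`L(½, φ_ξ) = 0` ⟹ no pole of the
continued Eisenstein family of the `φ_ξ`-block at `3/2`, at every level» (the scalar road's content: the vanishing numerator cancels the simple pole of the intertwining scalar).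
[cite: Rogawski1990, §13.9 p. 229 (ii)] [cite: Langlands1976, §7] [cite: MoeglinWaldspurger1995, IV.1.11] -/
theorem resGMidBlock_eq_bot_of_not_lHalfNeZero_of_letters
    (hVflat : ¬ LHalfNeZero (ξ.bcη⁻¹ * μω) → ∀ (K' : Subgroup (quasiSplit (↥(maximalRealSubfield L)) L (IsCMField.complexConj L) 3).Adelic) (ω : ↥K' →* ℂ), ∀ φ ∈ chiSectionSpacePair (ξ.bcη⁻¹ * ξ.bcψ⁻¹ * μω) ξ.ψ K' (ω : ↥K' → ℂ), Continuous φ →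
      ∀ (Ec : ℂ → (quasiSplit (↥(maximalRealSubfield L)) L (IsCMField.complexConj L) 3).Adelic → ℂ) (Sp : Finset ℂ), (∀ s ∈ Sp, s.im = 0 ∧ 1 < s.re ∧ s.re ≤ 2) →
        (∀ g, DifferentiableOn ℂ (fun z => Ec z g) ({z : ℂ | 1 < z.re} \ (↑Sp : Set ℂ))) → (∀ z : ℂ, 2 < z.re → Ec z = eisensteinSeriesU (flatSectionU φ z)) →
          ∀ g, Tendsto (fun z => (z - (3 : ℂ) / 2) * Ec z g) (𝓝[≠] ((3 : ℂ) / 2)) (𝓝 0)) :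
    ¬ LHalfNeZero (ξ.bcη⁻¹ * μω) → resGMidBlock L μ ξ μω = ⊥ := fun hL =>
  resGMidBlock_eq_bot_of_noMiddlePole L μ ξ μω (hVflat hL)

/-- **CONTRAPOSITIVE — A NON-ZERO MIDDLE BLOCK FORCES `L(½, φ_ξ) ≠ 0`** (modulo `hV♭`): the shape in which ★ F2_qs's index passage `OneDimAutRepH L → {ξ ∣ LHalfNeZero (ξ.bcη⁻¹ * μω)}`
consumes (V♭) for #2♯. [cite: Rogawski1990, §13.9 p. 229 (ii)] [cite: Langlands1976, §7] -/
theorem lHalfNeZero_of_resGMidBlock_ne_bot_of_letters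
    (hVflat : ¬ LHalfNeZero (ξ.bcη⁻¹ * μω) → ∀ (K' : Subgroup (quasiSplit (↥(maximalRealSubfield L)) L (IsCMField.complexConj L) 3).Adelic) (ω : ↥K' →* ℂ), ∀ φ ∈ chiSectionSpacePair (ξ.bcη⁻¹ * ξ.bcψ⁻¹ * μω) ξ.ψ K' (ω : ↥K' → ℂ), Continuous φ →
      ∀ (Ec : ℂ → (quasiSplit (↥(maximalRealSubfield L)) L (IsCMField.complexConj L) 3).Adelic → ℂ) (Sp : Finset ℂ), (∀ s ∈ Sp, s.im = 0 ∧ 1 < s.re ∧ s.re ≤ 2) →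
        (∀ g, DifferentiableOn ℂ (fun z => Ec z g) ({z : ℂ | 1 < z.re} \ (↑Sp : Set ℂ))) → (∀ z : ℂ, 2 < z.re → Ec z = eisensteinSeriesU (flatSectionU φ z)) →
          ∀ g, Tendsto (fun z => (z - (3 : ℂ) / 2) * Ec z g) (𝓝[≠] ((3 : ℂ) / 2)) (𝓝 0))
    (hne : (resGMidBlock L μ ξ μω).toSubmodule ≠ ⊥) : LHalfNeZero (ξ.bcη⁻¹ * μω) := by
  by_contra hL
  exact hne (by rw [resGMidBlock_eq_bot_of_not_lHalfNeZero_of_letters L μ ξ μω hVflat hL, ClosedSubrep.toSubmodule_bot])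

end Summit.HodgeConjecture.HodgeConjecture.R90.S8

end
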